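import Summits.CriticalPhenomena.PercolationContinuityZ3.Theorems.PercNearOneGluingNoHeavyLowerTailSunflowerRestrictionSingleton
import Summits.CriticalPhenomena.PercolationContinuityZ3.Theorems.PercNearOneGluingNoHeavyLowerTailSunflowerWeightedGladkov
import HarnessLib

/-!
# `NoHeavyLowerTail` (crux stmt-CriticalPhenomena-4575), abstract sunflower cubic: RESTRICTION MONOTONICITY (MZ) on every sub-cube
# that misses a petal — (MZ), hence the partition lemma, for sunflowers with at most two non-empty petals

Support file (seat `prim-l12-p2` gen 8; `--supports stmt-CriticalPhenomena-4575`; companion of `…SunflowerRestrictionSingleton` (p222183),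
`…SunflowerAntipodalGladkov` (p214186), `…SunflowerPartitionReduction` (p217435)).  Memo: run/shared/lean/prim/prim-l12/prim-l12-p2/FINDING-g8-MZ-PETAL-FREE.md;
the statement was suggested by seat `prim-ineq-prove-1` (gen 28, FINDING-LIFTCONE §5).  Nothing is asserted about the crux; no `sorry`.

SETTING.  `F : Sunflower α` (monotone `lab : 2^α → M₃`, `0` bottom, `1,2,3` petals, `4` top), the nested partition sum
`nested W (s6H ∘ lab)` `= F.ZP W ∅ ∅ ∅` on a sub-cube `2^W`, and the conjecture `RestrictionMonotonicity` (MZ):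
`F.ZP W ∅ ∅ ∅ ≤ F.ZP (insert e W) ∅ ∅ ∅` for `e ∉ W`.

MAIN RESULT (this work): **(MZ) holds whenever some petal value `k` does not occur among the labels of the subsets of `insert e W`**
(`Sunflower.ZP_le_ZP_insert_of_petal_free`); in particular (MZ) holds at every coordinate for every sunflower with an EMPTY PETAL
(`Sunflower.ZP_le_ZP_insert_of_petal_empty`), and so does the partition lemma (`Sunflower.ZH_nonneg_of_petal_empty`, also immediate from Gladkov).
Together with `…RestrictionSingleton` / `…RestrictionSeriesPair` these are the proved cases of (MZ); the general case needs the "lifted rainbow"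
terms (three distinct petals), which are absent here.

PROOF.  Without the petal `k` no label triple is a rainbow, and the cubic kernel is EXACTLY its spectator form
`s6H x y z = sp x · kk y z + sp y · kk x z + sp z · kk x y` (`sp` = indicator of `{0, ⊤}`, written inline as an `if`; `kk` = antipodal Gladkov kernel;
`s6H_eq_spectator`, `decide`; cf. `s6H_eq_spec` of `…SunflowerSpectatorRows`, whose rainbow term `triP` vanishes here).  Hence, with `ψX := lab (insert e X)`, `φ := lab` and the two-block sums `σ₀₀(U) = Σ_{S⊆U} kk (φS) (φ(U∖S))`,
`σ₁₀(U) = Σ_{S⊆U} kk (ψS) (φ(U∖S))` (block symmetries `nested_swap12/23` of p222183):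
  `ZP W = 3·Σ_X sp(φX) σ₀₀(W∖X)`,   `ZP (insert e W) = 3·[Σ_X sp(ψX) σ₀₀(W∖X) + 2·Σ_X sp(φX) σ₁₀(W∖X)]`   (`Sunflower.nested_insert_eq`),
and (MZ) follows from the pointwise-in-`X` comparison `sp(φX) σ₀₀ ≤ sp(ψX) σ₀₀ + 2 sp(φX) σ₁₀`, a consequence of `0 ≤ σ₀₀` (antipodal Gladkov),
`0 ≤ σ₁₀`, `0 ≤ σ₁₁` (polarised antipodal Gladkov with offsets `{e} ⊇ ∅`, `{e} ⊇ {e}`) and the summed exchange inequality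
`σ₀₀ + σ₁₁ ≤ 2σ₁₀` (`kk_submod` at every antipodal pair; `Sunflower.antipodal_le_two_mul_insert`).
-/

namespace Summit.CriticalPhenomena.PercolationContinuityZ3.Theorems.SunflowerPartition

open Finset

/-! ## The spectator form of the kernel away from one petal -/

/-- **Spectator form of `s6H` away from a petal**: if the petal value `k` does not occur among `x, y, z`, then
`s6H x y z = sp x · kk y z + sp y · kk x z + sp z · kk x y` (no rainbow term). [this work] -/
theorem s6H_eq_spectator : ∀ k x y z : Fin 5, (k = 1 ∨ k = 2 ∨ k = 3) → x ≠ k → y ≠ k → z ≠ k →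
    s6H x y z = (if x = 0 ∨ x = 4 then (1 : ℤ) else 0) * kk y z + (if y = 0 ∨ y = 4 then (1 : ℤ) else 0) * kk x z + (if z = 0 ∨ z = 4 then (1 : ℤ) else 0) * kk x y := by
  decide

variable {α : Type*} [DecidableEq α]

/-! ## Two-block sums with one block lifted by a coordinate -/

/-- `0 ≤ σ₁₀(U) = Σ_{S ⊆ U} kk (lab (insert e S)) (lab (U ∖ S))` (polarised antipodal Gladkov, offsets `{e} ⊇ ∅`). [this work] -/
theorem Sunflower.antipodal_insert_nonneg (F : Sunflower α) (U : Finset α) (e : α) :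
    0 ≤ ∑ S ∈ U.powerset, kk (F.lab (insert e S)) (F.lab (U \ S)) := by
  have h := F.antipodal_sum_nonneg U {e} ∅ (empty_subset _)
  refine le_of_le_of_eq h (sum_congr rfl fun S _ => ?_)
  rw [empty_union, ← insert_eq]

/-- `0 ≤ σ₁₁(U) = Σ_{S ⊆ U} kk (lab (insert e S)) (lab (insert e (U ∖ S)))` (polarised antipodal Gladkov, offsets `{e} ⊇ {e}`). [this work] -/
theorem Sunflower.antipodal_insert_insert_nonneg (F : Sunflower α) (U : Finset α) (e : α) :
    0 ≤ ∑ S ∈ U.powerset, kk (F.lab (insert e S)) (F.lab (insert e (U \ S))) := by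
  have h := F.antipodal_sum_nonneg U {e} {e} subset_rfl
  refine le_of_le_of_eq h (sum_congr rfl fun S _ => ?_)
  rw [← insert_eq, ← insert_eq]

/-- **Summed exchange inequality** `σ₀₀ ≤ σ₀₀ + σ₁₁ ≤ 2σ₁₀`: the sub-cube antipodal Gladkov sum is at most twice the sum with one block lifted
by `e` (`kk_submod` at every antipodal pair, the involution `S ↦ U ∖ S` with `kk_comm` (p218772), and `0 ≤ σ₁₁`). [this work] -/
theorem Sunflower.antipodal_le_two_mul_insert (F : Sunflower α) (U : Finset α) (e : α) :
    ∑ S ∈ U.powerset, kk (F.lab S) (F.lab (U \ S)) ≤ 2 * ∑ S ∈ U.powerset, kk (F.lab (insert e S)) (F.lab (U \ S)) := by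
  have hpt : ∀ S ∈ U.powerset,
      kk (F.lab S) (F.lab (U \ S)) + kk (F.lab (insert e S)) (F.lab (insert e (U \ S)))
        ≤ kk (F.lab (insert e S)) (F.lab (U \ S)) + kk (F.lab S) (F.lab (insert e (U \ S))) :=
    fun S _ => kk_submod _ _ _ _ (F.lab_mono (subset_insert e S)) (F.lab_mono (subset_insert e (U \ S)))
  have hsum := sum_le_sum hpt
  rw [sum_add_distrib, sum_add_distrib] at hsum
  have hsym : ∑ S ∈ U.powerset, kk (F.lab S) (F.lab (insert e (U \ S)))
      = ∑ S ∈ U.powerset, kk (F.lab (insert e S)) (F.lab (U \ S)) := by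
    refine sum_nbij' (fun S => U \ S) (fun S => U \ S) ?_ ?_ ?_ ?_ ?_
    · intro S _; exact mem_powerset.2 sdiff_subset
    · intro S _; exact mem_powerset.2 sdiff_subset
    · intro S hS; exact Finset.sdiff_sdiff_eq_self (mem_powerset.1 hS)
    · intro S hS; exact Finset.sdiff_sdiff_eq_self (mem_powerset.1 hS)
    · intro S hS; rw [Finset.sdiff_sdiff_eq_self (mem_powerset.1 hS), kk_comm]
  have h11 := F.antipodal_insert_insert_nonneg U e
  linarith

/-- **Core comparison** (pointwise in the spectator block `X`): with `σ₀₀, σ₁₀` the two-block sums on `W ∖ X`,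
`Σ_X sp(lab X)·σ₀₀ ≤ Σ_X sp(lab (insert e X))·σ₀₀ + 2·Σ_X sp(lab X)·σ₁₀`. [this work] -/
theorem Sunflower.spectator_core_le (F : Sunflower α) (W : Finset α) (e : α) :
    nested W (fun X S T => (if F.lab X = 0 ∨ F.lab X = 4 then (1 : ℤ) else 0) * kk (F.lab S) (F.lab T))
      ≤ nested W (fun X S T => (if F.lab (insert e X) = 0 ∨ F.lab (insert e X) = 4 then (1 : ℤ) else 0) * kk (F.lab S) (F.lab T))
        + 2 * nested W (fun X S T => (if F.lab X = 0 ∨ F.lab X = 4 then (1 : ℤ) else 0) * kk (F.lab (insert e S)) (F.lab T)) := by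
  unfold nested
  rw [mul_sum, ← sum_add_distrib]
  refine sum_le_sum fun X _ => ?_
  rw [← mul_sum, ← mul_sum, ← mul_sum]
  have h00 := F.antipodal_gladkov (W \ X)
  have h10 := F.antipodal_insert_nonneg (W \ X) e
  have hle := F.antipodal_le_two_mul_insert (W \ X) e
  by_cases h0 : (F.lab X = 0 ∨ F.lab X = 4) <;> by_cases h1 : (F.lab (insert e X) = 0 ∨ F.lab (insert e X) = 4) <;>
    simp only [h0, h1, if_true, if_false] <;> linarith

/-! ## (MZ) on a sub-cube missing a petal -/

/-- **Restriction monotonicity away from a petal, nested form** (this work): if the petal value `k` is not the label of any subset of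
`insert e W` (`e ∉ W`), then `nested W (s6H ∘ lab) ≤ nested (insert e W) (s6H ∘ lab)`. -/
theorem Sunflower.nested_le_nested_insert_of_petal_free (F : Sunflower α) (W : Finset α) (e : α) (he : e ∉ W) (k : Fin 5)
    (hk : k = 1 ∨ k = 2 ∨ k = 3) (hfree : ∀ S, S ⊆ insert e W → F.lab S ≠ k) :
    nested W (fun X S T => s6H (F.lab X) (F.lab S) (F.lab T))
      ≤ nested (insert e W) (fun X S T => s6H (F.lab X) (F.lab S) (F.lab T)) := by
  rw [F.nested_insert_eq W e he]
  have hW : ∀ Y, Y ⊆ W → F.lab Y ≠ k := fun Y hY => hfree Y (hY.trans (subset_insert e W))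
  -- the unlifted sum in spectator form: three equal spectator-Gladkov sums
  have hT0 : nested W (fun X S T => s6H (F.lab X) (F.lab S) (F.lab T))
      = 3 * nested W (fun X S T => (if F.lab X = 0 ∨ F.lab X = 4 then (1 : ℤ) else 0) * kk (F.lab S) (F.lab T)) := by
    have step : nested W (fun X S T => s6H (F.lab X) (F.lab S) (F.lab T))
        = nested W (fun X S T => (if F.lab X = 0 ∨ F.lab X = 4 then (1 : ℤ) else 0) * kk (F.lab S) (F.lab T))
          + nested W (fun X S T => (if F.lab S = 0 ∨ F.lab S = 4 then (1 : ℤ) else 0) * kk (F.lab X) (F.lab T))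
          + nested W (fun X S T => (if F.lab T = 0 ∨ F.lab T = 4 then (1 : ℤ) else 0) * kk (F.lab X) (F.lab S)) := by
      unfold nested
      rw [← sum_add_distrib, ← sum_add_distrib]
      refine sum_congr rfl fun X hX => ?_
      rw [← sum_add_distrib, ← sum_add_distrib]
      refine sum_congr rfl fun S hS => ?_
      have hX' : X ⊆ W := mem_powerset.1 hX
      have hS' : S ⊆ W := (mem_powerset.1 hS).trans sdiff_subset
      have hT' : (W \ X) \ S ⊆ W := sdiff_subset.trans sdiff_subset
      exact s6H_eq_spectator k _ _ _ hk (hW _ hX') (hW _ hS') (hW _ hT')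
    have e2 : nested W (fun X S T => (if F.lab S = 0 ∨ F.lab S = 4 then (1 : ℤ) else 0) * kk (F.lab X) (F.lab T))
        = nested W (fun X S T => (if F.lab X = 0 ∨ F.lab X = 4 then (1 : ℤ) else 0) * kk (F.lab S) (F.lab T)) := by
      rw [nested_swap12]
    have e3 : nested W (fun X S T => (if F.lab T = 0 ∨ F.lab T = 4 then (1 : ℤ) else 0) * kk (F.lab X) (F.lab S))
        = nested W (fun X S T => (if F.lab X = 0 ∨ F.lab X = 4 then (1 : ℤ) else 0) * kk (F.lab S) (F.lab T)) := by
      rw [nested_swap23, nested_swap12]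
    rw [step, e2, e3]
    ring
  -- the lifted sum in spectator form
  have hT1 : nested W (fun X S T => s6H (F.lab (insert e X)) (F.lab S) (F.lab T))
      = nested W (fun X S T => (if F.lab (insert e X) = 0 ∨ F.lab (insert e X) = 4 then (1 : ℤ) else 0) * kk (F.lab S) (F.lab T))
        + 2 * nested W (fun X S T => (if F.lab X = 0 ∨ F.lab X = 4 then (1 : ℤ) else 0) * kk (F.lab (insert e S)) (F.lab T)) := by
    have step : nested W (fun X S T => s6H (F.lab (insert e X)) (F.lab S) (F.lab T))
        = nested W (fun X S T => (if F.lab (insert e X) = 0 ∨ F.lab (insert e X) = 4 then (1 : ℤ) else 0) * kk (F.lab S) (F.lab T))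
          + nested W (fun X S T => (if F.lab S = 0 ∨ F.lab S = 4 then (1 : ℤ) else 0) * kk (F.lab (insert e X)) (F.lab T))
          + nested W (fun X S T => (if F.lab T = 0 ∨ F.lab T = 4 then (1 : ℤ) else 0) * kk (F.lab (insert e X)) (F.lab S)) := by
      unfold nested
      rw [← sum_add_distrib, ← sum_add_distrib]
      refine sum_congr rfl fun X hX => ?_
      rw [← sum_add_distrib, ← sum_add_distrib]
      refine sum_congr rfl fun S hS => ?_
      have hX' : insert e X ⊆ insert e W := insert_subset_insert e (mem_powerset.1 hX)
      have hS' : S ⊆ W := (mem_powerset.1 hS).trans sdiff_subset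
      have hT' : (W \ X) \ S ⊆ W := sdiff_subset.trans sdiff_subset
      exact s6H_eq_spectator k _ _ _ hk (hfree _ hX') (hW _ hS') (hW _ hT')
    have e5 : nested W (fun X S T => (if F.lab T = 0 ∨ F.lab T = 4 then (1 : ℤ) else 0) * kk (F.lab (insert e X)) (F.lab S))
        = nested W (fun X S T => (if F.lab S = 0 ∨ F.lab S = 4 then (1 : ℤ) else 0) * kk (F.lab (insert e X)) (F.lab T)) := by
      rw [nested_swap23]
    have e6 : nested W (fun X S T => (if F.lab S = 0 ∨ F.lab S = 4 then (1 : ℤ) else 0) * kk (F.lab (insert e X)) (F.lab T))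
        = nested W (fun X S T => (if F.lab X = 0 ∨ F.lab X = 4 then (1 : ℤ) else 0) * kk (F.lab (insert e S)) (F.lab T)) := by
      rw [nested_swap12]
    rw [step, e5, e6]
    ring
  have hC := F.spectator_core_le W e
  rw [hT0, hT1]
  linarith

/-- **(MZ) away from a petal, `RestrictionMonotonicity` format** (this work): if `e ∉ W` and the petal value `k ∈ {1,2,3}` is not the
label of any subset of `insert e W`, then `F.ZP W ∅ ∅ ∅ ≤ F.ZP (insert e W) ∅ ∅ ∅`. -/
theorem Sunflower.ZP_le_ZP_insert_of_petal_free (F : Sunflower α) (W : Finset α) (e : α) (he : e ∉ W) (k : Fin 5)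
    (hk : k = 1 ∨ k = 2 ∨ k = 3) (hfree : ∀ S, S ⊆ insert e W → F.lab S ≠ k) :
    F.ZP W ∅ ∅ ∅ ≤ F.ZP (insert e W) ∅ ∅ ∅ := by
  rw [F.ZP_empty_eq_nested, F.ZP_empty_eq_nested]
  exact F.nested_le_nested_insert_of_petal_free W e he k hk hfree

/-- **(MZ) for sunflowers with an empty petal** (this work): if the petal value `k ∈ {1,2,3}` never occurs (at most two non-empty petals),
then restriction monotonicity holds at every coordinate: `e ∉ W → F.ZP W ∅ ∅ ∅ ≤ F.ZP (insert e W) ∅ ∅ ∅`. -/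
theorem Sunflower.ZP_le_ZP_insert_of_petal_empty (F : Sunflower α) (k : Fin 5) (hk : k = 1 ∨ k = 2 ∨ k = 3)
    (hempty : ∀ S, F.lab S ≠ k) (W : Finset α) (e : α) (he : e ∉ W) :
    F.ZP W ∅ ∅ ∅ ≤ F.ZP (insert e W) ∅ ∅ ∅ :=
  F.ZP_le_ZP_insert_of_petal_free W e he k hk fun S _ => hempty S

/-- An empty petal in terms of the up-sets: if `V i ⊆ A` then the petal label `k = i+1` never occurs. [this work] -/
theorem Sunflower.lab_ne_of_V_subset_A (F : Sunflower α) {i : Fin 3} {k : Fin 5} (hik : (k : ℕ) = (i : ℕ) + 1)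
    (hi : F.V i ⊆ F.A) (S : Finset α) : F.lab S ≠ k := by
  intro h
  unfold Sunflower.lab at h
  split_ifs at h with hA h0 h1 h2
  · have h' := congrArg Fin.val h
    omega
  · have h' := congrArg Fin.val h
    have hi0 : i = 0 := Fin.ext (by omega)
    subst hi0
    exact hA (hi h0)
  · have h' := congrArg Fin.val h
    have hi1 : i = 1 := Fin.ext (by omega)
    subst hi1
    exact hA (hi h1)
  · have h' := congrArg Fin.val h
    have hi2 : i = 2 := Fin.ext (by omega)
    subst hi2
    exact hA (hi h2)
  · have h' := congrArg Fin.val h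
    omega

/-- **Partition lemma on every sub-cube for sunflowers with an empty petal** (this work; also immediate from antipodal Gladkov since there are
no rainbows): `0 ≤ F.ZP W ∅ ∅ ∅` for every `W`, by induction on `W` using `ZP_le_ZP_insert_of_petal_empty`. -/
theorem Sunflower.ZP_nonneg_of_petal_empty (F : Sunflower α) (k : Fin 5) (hk : k = 1 ∨ k = 2 ∨ k = 3)
    (hempty : ∀ S, F.lab S ≠ k) (W : Finset α) : 0 ≤ F.ZP W ∅ ∅ ∅ := by
  induction W using Finset.induction_on with
  | empty => rw [F.ZP_empty]
  | insert e W' he ih => exact le_trans ih (F.ZP_le_ZP_insert_of_petal_empty k hk hempty W' e he)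

/-- Whole-type form: a sunflower with an empty petal satisfies the partition lemma `0 ≤ ZH`. [this work] -/
theorem Sunflower.ZH_nonneg_of_petal_empty {β : Type*} [Fintype β] [DecidableEq β] (F : Sunflower β) (k : Fin 5)
    (hk : k = 1 ∨ k = 2 ∨ k = 3) (hempty : ∀ S, F.lab S ≠ k) : 0 ≤ F.ZH := by
  rw [← F.ZP_univ_empty]
  exact F.ZP_nonneg_of_petal_empty k hk hempty univ

end Summit.CriticalPhenomena.PercolationContinuityZ3.Theorems.SunflowerPartition
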